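import Literature.NumberTheory.FaltingsSerre.ResidualIdentificationOfKernel
import Literature.NumberTheory.FaltingsSerre.S6Order72
import HarnessLib

/-!
# `N = 353`: the image hypothesis from the count `#im ρ̄_A = 72`

[BPPTVY] = Brumer–Pacetti–Poor–Tornaría–Voight–Yuen, *On the paramodularity of typical abelian
surfaces*, Algebra & Number Theory 13:5 (2019), Thm 7.2.1 pp. 1189–1190: "For `A`, we find the
2-torsion field generated by the splitting field of the polynomial `x⁶ + 2x⁴ + 2x³ + 5x² + 2x + 1` and
Galois group `S₃ ≀ C₂`."  The kernel-identification instance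
`Paramodular353.paramodular_353_cited_of_kernel` (`ResidualIdentificationOfKernel.lean`) takes the
residual image of `A₃₅₃` as a CONJUGATE OF THE STANDARD `ι(S₃ ≀ S₂)` (binder `h₁`).  By
`S6Order72.lean` (every subgroup of `S₆` of order `72` is such a conjugate) that binder is discharged
from the COUNT `#im ρ̄_A = 72` — the order of `Gal(ℚ(A[2]) | ℚ)`, which is what a certificate
producer computes — exactly as the `S₆` instances use `#im ρ̄ = 720`.

* `Paramodular353.paramodular_353_cited_of_kernel_of_card` — `paramodular_353_cited_of_kernel` with
  `h₁` replaced by `h72 : Nat.card (im ρ̄_A) = 72`.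
-/

noncomputable section

namespace Literature.NumberTheory.FaltingsSerre

open Polynomial IsDedekindDomain Field Equiv
open Literature.NumberTheory.GaloisRepresentations Literature.NumberTheory.FaltingsSerre.GSp4F2
  Literature.NumberTheory.Automorphic.Paramodular Literature.NumberTheory.Automorphic
  Literature.AlgebraicGeometry.Motives
open scoped NumberField

namespace Paramodular353

/-- **`A₃₅₃` paramodular away from `353`, form side cited, Step 1 (R) in the kernel, image type from
the count.**  As `paramodular_353_cited_of_kernel`, with the image hypothesis `h₁` (a conjugate of
`ι(S₃ ≀ S₂)`) DERIVED from `h72 : #im ρ̄_A = 72` by `GSp4F2.residual_range_S3wrS2_of_card` (the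
symplectic containment `im ρ̄_A ≤ ι(S₆)` comes from the certificate's similitude data).  Remaining
certificate-attested Step-1 data: `hK` (part (F), field identification), `h72` (the order of the Galois
group of the `2`-division field), `hb11 : b₁₁(A) = 1` and `hf11 : (a₁₁, b₁₁)(f) = (2, 1)` [(7.2.2)].
[cite: BrumerEtAl2019, Thm 7.2.1 pp. 1189–1190; (7.2.2) p. 1189; (5.1.8) p. 1174] -/
theorem paramodular_353_cited_of_kernel_of_card
    {A : AbelianVariety ℚ} {f : Matrix (Fin 2) (Fin 2) ℂ → ℂ} {ρA : FramedGaloisRep ℚ ℤ_[2] 4}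
    {b : Module.Basis (Fin 4) ℚ_[2] (A.rationalTateModule 2)}
    (h438 : BrumerEtAl2019.existsIntegralSymplecticGaloisRep_two_primeLevel)
    (G : GaloisCertificate353 ρA)
    (h72 : Nat.card (residual ρA.toMonoidHom).range = 72)
    (hframe : A.IsFrameOfTateRep 2 b (rationalize ρA)) (aA bA af bf : ℕ → ℤ)
    (hK : KernelIdentification 353 af bf ρA)
    (hA : ∀ p : ℕ, p.Prime → ¬ p ∣ 353 →
      A.HasGoodEulerFactorAt p ((lPolynomialOfSurface p (aA p) (bA p)).map (Int.castRingHom ℚ)))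
    (hb11 : bA 11 = 1)
    (h5 : ∀ p ∈ checkPrimes353, aA p = af p)
    (hcusp : IsParamodularCuspForm 353 2 f) (hne : ∃ Z ∈ siegelUpperHalfSpace 2, f Z ≠ 0)
    (hfe : ∀ p : ℕ, p.Prime → ¬ p ∣ 353 →
      HasSpinorEulerFactorAt 2 p f ((lPolynomialOfSurface p (af p) (bf p)).map (Int.castRingHom ℂ)))
    (hf3 : af 3 = -2 ∧ bf 3 = 4) (hf11 : af 11 = 2 ∧ bf 11 = 1) (h2 : aA 2 = af 2 ∧ bA 2 = bf 2) :
    IsParamodularAwayFrom A 353 f :=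
  have G' : GaloisCertificate 353 checkPrimes353 cyclotomicMultiplier ρA := G
  paramodular_353_cited_of_kernel h438 G
    (GSp4F2.residual_range_S3wrS2_of_card ρA cyclotomicMultiplier G'.similitude h72)
    hframe aA bA af bf hK hA hb11 h5 hcusp hne hfe hf3 hf11 h2

end Paramodular353

end Literature.NumberTheory.FaltingsSerre

end
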